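/-
Copyright (c) 2026 the pub-hodgecm-mathlib formalisation cell (harness21).  Prover seat hodgecm-mathlib-K2Liu-p14 (g4) (writer of record of the (K1b-♮)
package ★ p863141 `K2LiuKindOneLineTermPackage`, K1b∕ρ desk; LEAD F0P6-plan (g14) BATCH #139 (1)), Track B «K2-LIT» ∕ hLiu418 #184♮, socket #41 KIND 1:
(K1b-ENGINE) THE K1-b♮ BLOCK FROM A PINNED TERM, ITS `D`-POLYNOMIAL DECAY, AND THE INTRINSIC SUPPORT LETTERS.  THEOREMS ONLY.
-/
import Summits.HodgeConjecture.HodgeConjecture.Theorems.K2LiuKindOneLineTermPackage       -- ★ p863141 (this seat): the package from four letters + §1 identity-theorem upgrade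
import Summits.HodgeConjecture.HodgeConjecture.Theorems.K2LiuKindOneLineSupportIntrinsic  -- ★ (this seat) (P-supp): `hsupp_middle_of_letters`
import Summits.HodgeConjecture.HodgeConjecture.Theorems.K2LiuStandardFamilyUniformLevel   -- ★ p863294 (ρ7) K2E3-p03: `exists_levelSubgroup_of_isStandardSectionFamily`
import HarnessLib

/-!
# Crux `HLiu418`, socket #41, KIND 1 — (K1b-ENGINE) `K2LiuKindOneLineTermEngine`: THE K1-b♮ BLOCK FROM A PINNED TERM WITH `D`-POLYNOMIAL DECAY

Cell `hodgecm-mathlib`, crux item hLiu418 = `stmt-HodgeConjecture-24832` (helper lane `--supports … --as helper`, count-neutral), route of record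
`HCCMUnconditional`; squad K2 ∕ K2Liu, road `K2_Liu`, socket #41 `sig_K2LiuSiegelEisensteinContinuation`, KIND 1, block K1-b♮ (the twelve letters
`Ebc hEbd hEbc τb hτb Nb hdecb Cb κb hCb hκb hsuppb` of ★ ED. 20 `K2LiuSiegelEisensteinContinuationTopTwentySocket` :109–:126; package ★ p863141).

THE MATHEMATICS [KudlaRallis1994, §2 (2.10)–(2.12)], [MoeglinWaldspurger1995, I.2.6, II.1.7, IV.1.9], [Shimura1997, §18.4 Prop. 18.14], [Tan1999, §4 Prop. 4.8].
★ p863141 reduces the K1-b♮ block to four letters about ONE function `E`.  This file fixes the SHAPE OF `E` once and for all and discharges two of the four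
letters STRUCTURALLY: `E S s h := T S s h` for RANK-ONE `S` (`S ≠ 0`, `det S = 0`) and `0` otherwise, where `T` — the PINNED TERM — is any function with
(hol) `s ↦ T S s x` holomorphic on `{0 < re s}` (rank-one `S`), (pin) `T S s h =` the TOP's normalised middle-cell term on `{n∕2 < re s}` (rank-one `S`; for the
line term of record `T` is ★ `K2LiuKindOnePin`'s `(∫β)⁻¹ • (C • W⁽ᴮ⁾ …)`), and (dec-D) a decay letter that may USE A DENOMINATOR OF `S`: near every `z` with
`0 < re z`, `‖T S s h‖ ≤ C · H(h)^a · D^{a₂} · exp(−c · H(h)^{−a'} · τ S) · (1 + τ S)^{N_b}` for every `D ≥ 1` with `D · S` integral (`τ S = ‖ι_∞ ∘ S‖`).  The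
SUPPORT letter is produced INTRINSICALLY by ★ (P-supp) `hsupp_middle_of_letters` from the level `(Kf, hKf)`, the `REST`-cell invariance `hrestL` and the lattice
letters `hlatU` at the uniform level of the family ★ (ρ7) `exists_levelSubgroup_of_isStandardSectionFamily`; ★ p863141 §1 (identity theorem) moves it to the whole window, where it FEEDS the decay letter: `E S s h ≠ 0 ⇒ ∃ D ≤ Cb · H(h)^κb`, so
`D^{a₂} ≤ Cb^{a₂} · H(h)^{κb a₂}` is absorbed into the height power — the TOP's `hdecb` shape with `τb S := ‖ι_∞ ∘ S‖`, `hτb := le_rfl`.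
* **`exists_kindOne_lineTerm_of_pinnedTerm`** — socket prefix VERBATIM; BY VALUE: the (P-supp) letters `hrestL` and `hlatU` (lattice letters for every open level
  `U ≤ H(𝔸_f)`; the level itself is ★ (ρ7) `exists_levelSubgroup_of_isStandardSectionFamily`), the pinned term `T` with `hTd` (hol), `hTpin` (pin), `Nb` and `hTdec`
  (dec-D) ⊢ the twelve K1-b♮ letters of ★ ED. 20 :109–:126 TOKEN FOR TOKEN.
HONEST LABEL.  Count-neutral helper, hypothesis-first in `hrestL hlatU T hTd hTpin Nb hTdec` (payers: (ρ8), (P-supp-lat), ★ `K2LiuKindOneLinePin` for `T hTd hTpin`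
at `n = 2`, (P-dec) for `Nb hTdec`); it closes no socket by itself: `HC_CM` is proved only modulo the 7 printed citations (2 remaining named
inputs: hLiu418 = `stmt-HodgeConjecture-24832`, h413 = `stmt-HodgeConjecture-24833`) until rung 0 closes.

## References
* [KudlaRallis1994] S. Kudla, S. Rallis, Ann. of Math. 140 (1994): §2 (2.10)–(2.12).
* [MoeglinWaldspurger1995] C. Mœglin, J.-L. Waldspurger, *Spectral decomposition and Eisenstein series* (1995): I.2.6, II.1.7, IV.1.9.
* [Shimura1997] G. Shimura, CBMS 93 (1997): §18.4 Prop. 18.14.   * [Tan1999] V. Tan, Canad. J. Math. 51 (1999): §4 Prop. 4.8.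
-/

set_option autoImplicit false
-- the mandated namespace repeats the single-problem summit's segment (`HodgeConjecture.HodgeConjecture`)
set_option linter.dupNamespace false

noncomputable section

open scoped Matrix ENNReal NNReal Topology ComplexConjugate
open NumberField IsDedekindDomain MeasureTheory MeasureTheory.Measure Filter Set Function Metric
open Literature.NumberTheory.Automorphic Literature.NumberTheory.Automorphic.UnitaryGroup Literature.NumberTheory.GaloisRepresentations
open Literature.NumberTheory.GelbartRogawski1991 Literature.NumberTheory.GelbartRogawski1991.GRConstruction
open Literature.NumberTheory.K2Lit.SiegelDoubled Literature.MeasureTheory.Group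
open Literature.NumberTheory.Automorphic.IdeleClassGroup

namespace Summit.HodgeConjecture.HodgeConjecture.Cruxes.HLiu418.K2LiuKindOneLineTermEngine

open K2LiuSiegelUnipotentFourierDefs K2LiuSiegelUnipotentCharacters K2LiuUnipotentCoveringWeight K2LiuSiegelFourierCoeffDelta
open K2LiuKindOneLineTermPackage (support_of_support_on_halfPlane exists_kindOne_lineTermPackage_of_letters)
open K2LiuKindOneLineSupportIntrinsic (hsupp_middle_of_letters)
open K2LiuStandardFamilyUniformLevel (exists_levelSubgroup_of_isStandardSectionFamily conj_mem_of_archPart_eq_one)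

set_option maxHeartbeats 400000 in
open Classical in
/-- **(K1b-ENGINE) THE K1-b♮ BLOCK FROM A PINNED TERM.**  Socket prefix VERBATIM (`L e dV hdV hdV0 dW hdW hdW0 lam hlam hw 𝒦 h𝒦 f hstd hcont`, the carrier
`νN β hβ hβ0 hβtop K hK hβK`, O41.4's `wq hwq`); BY VALUE: the (P-supp) letters — the left-`N_Δ(L⁺)`-invariance `hrestL` of the `REST`-cell sum and the lattice
letters `hlatU` for every open level `U ≤ H(𝔸_f)` (the level of the family being ★ (ρ7)) —, and the PINNED TERM `T` with (hol) `hTd`, (pin) `hTpin` (the TOP's normalised middle-cell identity on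
`{n∕2 < re s}` for rank-one `S`), `Nb` and the `D`-POLYNOMIAL decay letter `hTdec` (for rank-one `S`, every denominator `D ≥ 1` of `S`, near every `z` with `0 < re z`).
THEN the twelve K1-b♮ letters of ★ ED. 20 :109–:126 hold, TOKEN FOR TOKEN, with `Ebc S s h := if S ≠ 0 ∧ det S = 0 then T S s h else 0` and `τb S := ‖ι_∞ ∘ S‖`
(support: ★ `hsupp_middle_of_letters` through the pin, moved to `{0 < re s}` by ★ p863141 §1; decay: the support denominator `D ≤ Cb · H(h)^κb` fed into `hTdec`).
[cite: KudlaRallis1994, §2 (2.10)–(2.12)] [cite: MoeglinWaldspurger1995, I.2.6, II.1.7, IV.1.9] [cite: Shimura1997, §18.4 Prop. 18.14] [cite: Tan1999, §4 Prop. 4.8] -/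
theorem exists_kindOne_lineTerm_of_pinnedTerm
    (L : Type) [Field L] [NumberField L] [IsCMField L] {n : ℕ} (e : Fin 2 × Fin 1 ≃ Fin n)
    (dV : Fin 2 → L) (hdV : ∀ i, IsCMField.complexConj L (dV i) = dV i) (hdV0 : ∀ i, dV i ≠ 0)
    (dW : Fin 1 → L) (hdW : ∀ i, IsCMField.complexConj L (dW i) = dW i) (hdW0 : ∀ i, dW i ≠ 0)
    (lam : IdeleClassGroup L →ₜ* Circle) (hlam : IsConjugateSymplectic L lam) (hw : HasWeight L lam 1)
    (𝒦 : IwasawaDatum L e dV hdV dW hdW) (h𝒦 : 𝒦.IsStd) (f : ℂ → HA L e dV hdV dW hdW → ℂ)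
    (hstd : IsStandardSectionFamily 𝒦 (toHeckeCharacter L lam⁻¹) f) (hcont : ∀ s, Continuous (f s))
    [MeasurableSpace (unipDelta L e dV hdV dW hdW)] [BorelSpace (unipDelta L e dV hdV dW hdW)]
    (νN : Measure (unipDelta L e dV hdV dW hdW)) [νN.IsHaarMeasure]
    (β : unipDelta L e dV hdV dW hdW → ℝ≥0∞) (hβ : IsCoveringWeight (unipDeltaRat L e dV hdV dW hdW) β)
    (hβ0 : ∫⁻ u, β u ∂νN ≠ 0) (hβtop : ∫⁻ u, β u ∂νN ≠ ∞)
    {K : Set (unipDelta L e dV hdV dW hdW)} (hK : IsCompact K) (hβK : ∀ u, β u ≤ K.indicator 1 u)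
    (wq : unipDeltaRat L e dV hdV dW hdW → ratH L e dV hdV dW hdW)
    (hwq : ∀ ν, ((wq ν : ratH L e dV hdV dW hdW) : HA L e dV hdV dW hdW) = weylDelta L e dV hdV dW hdW * ((ν : unipDelta L e dV hdV dW hdW) : HA L e dV hdV dW hdW))
    -- the (P-supp) letters BY VALUE: (ρ8) the `REST`-cell sum is left-`N_Δ(L⁺)`-invariant
    (hrestL : ∀ (s : ℂ) (γ : unipDeltaRat L e dV hdV dW hdW) (x : HA L e dV hdV dW hdW),
      (∑' q : ↥(({Quotient.mk (MulAction.orbitRel (siegelDeltaRat L e dV hdV dW hdW) (ratH L e dV hdV dW hdW)) 1} ∪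
            Set.range (fun ν : unipDeltaRat L e dV hdV dW hdW =>
              (Quotient.mk (MulAction.orbitRel (siegelDeltaRat L e dV hdV dW hdW) (ratH L e dV hdV dW hdW)) (wq ν) :
                SiegelDeltaQuot L e dV hdV dW hdW)))ᶜ : Set (SiegelDeltaQuot L e dV hdV dW hdW)),
          f s ((((Quotient.out (q : SiegelDeltaQuot L e dV hdV dW hdW) : ratH L e dV hdV dW hdW) : HA L e dV hdV dW hdW)) *
            ((((γ : unipDelta L e dV hdV dW hdW)) : HA L e dV hdV dW hdW) * x))) =
        ∑' q : ↥(({Quotient.mk (MulAction.orbitRel (siegelDeltaRat L e dV hdV dW hdW) (ratH L e dV hdV dW hdW)) 1} ∪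
            Set.range (fun ν : unipDeltaRat L e dV hdV dW hdW =>
              (Quotient.mk (MulAction.orbitRel (siegelDeltaRat L e dV hdV dW hdW) (ratH L e dV hdV dW hdW)) (wq ν) :
                SiegelDeltaQuot L e dV hdV dW hdW)))ᶜ : Set (SiegelDeltaQuot L e dV hdV dW hdW)),
          f s ((((Quotient.out (q : SiegelDeltaQuot L e dV hdV dW hdW) : ratH L e dV hdV dW hdW) : HA L e dV hdV dW hdW)) * x))
    -- (P-supp-lat) the lattice letters, for EVERY open level `U ≤ H(𝔸_f)` (by value)
    (hlatU : ∀ U : Subgroup (UnitaryGroup.finAdelic (Fp L) L (IsCMField.complexConj L) (n + n) (hermD L e dV hdV dW hdW)),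
      IsOpen (U : Set (UnitaryGroup.finAdelic (Fp L) L (IsCMField.complexConj L) (n + n) (hermD L e dV hdV dW hdW))) →
      ∃ (Tδ : Finset (HeightOneSpectrum (𝓞 L))) (δ : HeightOneSpectrum (𝓞 L) → ℕ) (k : ℕ), (∀ w ∉ Tδ, δ w = 0) ∧
        ∀ (S : skewMatrices ((IsCMField.complexConj L : L ≃ₐ[Fp L] L) : L →+* L) ((gramR L e dV hdV dW hdW).map (algebraMap (Fp L) L)))
          (h : HA L e dV hdV dW hdW),
          (∀ b : unipDelta L e dV hdV dW hdW,
            UnitaryGroup.archPart (Fp L) L (IsCMField.complexConj L) (n + n) (hermD L e dV hdV dW hdW) (b : HA L e dV hdV dW hdW) = 1 →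
            UnitaryGroup.finPart (Fp L) L (IsCMField.complexConj L) (n + n) (hermD L e dV hdV dW hdW) (h⁻¹ * (b : HA L e dV hdV dW hdW) * h) ∈ U →
            unipDeltaChar L e dV hdV dW hdW (S : Matrix (Fin n) (Fin n) L) (b : HA L e dV hdV dW hdW) = 1) →
          ∀ w : HeightOneSpectrum (𝓞 L), ∃ m : ℕ,
            ((Ideal.absNorm w.asIdeal : ℕ) : ℝ) ^ m ≤
                ((Ideal.absNorm w.asIdeal : ℕ) : ℝ) ^ δ w * (GLn.localHeight (n + n) L w (h : GL (Fin (n + n)) (AdeleRing (𝓞 L) L)) : ℝ) ^ k ∧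
              ∀ a b, Valued.v ((((S : Matrix (Fin n) (Fin n) L) a b : L)) : w.adicCompletion L) ≤ WithZero.exp (m : ℤ))
    -- THE PINNED TERM BY VALUE: (hol), (pin), and the `D`-polynomial decay letter
    (T : skewMatrices ((IsCMField.complexConj L : L ≃ₐ[Fp L] L) : L →+* L) ((gramR L e dV hdV dW hdW).map (algebraMap (Fp L) L)) → ℂ → HA L e dV hdV dW hdW → ℂ)
    (hTd : ∀ S : skewMatrices ((IsCMField.complexConj L : L ≃ₐ[Fp L] L) : L →+* L) ((gramR L e dV hdV dW hdW).map (algebraMap (Fp L) L)),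
      (S : Matrix (Fin n) (Fin n) L) ≠ 0 → (S : Matrix (Fin n) (Fin n) L).det = 0 → ∀ x, DifferentiableOn ℂ (fun s => T S s x) {s : ℂ | 0 < s.re})
    (hTpin : ∀ S : skewMatrices ((IsCMField.complexConj L : L ≃ₐ[Fp L] L) : L →+* L) ((gramR L e dV hdV dW hdW).map (algebraMap (Fp L) L)),
      (S : Matrix (Fin n) (Fin n) L) ≠ 0 → (S : Matrix (Fin n) (Fin n) L).det = 0 → ∀ (s : ℂ) (h : HA L e dV hdV dW hdW), (n : ℝ) / 2 < s.re →
        ((∫⁻ u, β u ∂νN).toReal⁻¹ : ℝ) •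
          (∫ u, (β u).toReal • (conj (unipDeltaChar L e dV hdV dW hdW (S : Matrix (Fin n) (Fin n) L) (u : HA L e dV hdV dW hdW) : ℂ) *
            (∑' q : ↥(({Quotient.mk (MulAction.orbitRel (siegelDeltaRat L e dV hdV dW hdW) (ratH L e dV hdV dW hdW)) 1} ∪
              Set.range (fun ν : unipDeltaRat L e dV hdV dW hdW =>
                (Quotient.mk (MulAction.orbitRel (siegelDeltaRat L e dV hdV dW hdW) (ratH L e dV hdV dW hdW)) (wq ν) :
                  SiegelDeltaQuot L e dV hdV dW hdW)))ᶜ : Set (SiegelDeltaQuot L e dV hdV dW hdW)),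
              f s ((((Quotient.out (q : SiegelDeltaQuot L e dV hdV dW hdW) : ratH L e dV hdV dW hdW) : HA L e dV hdV dW hdW)) *
                ((u : HA L e dV hdV dW hdW) * h)))) ∂νN) = T S s h)
    (Nb : ℕ)
    (hTdec : ∀ z : ℂ, 0 < z.re → ∃ C a a₂ c a' r : ℝ, 0 ≤ C ∧ 0 ≤ a ∧ 0 ≤ a₂ ∧ 0 < c ∧ 0 ≤ a' ∧ 0 < r ∧
      ∀ S : skewMatrices ((IsCMField.complexConj L : L ≃ₐ[Fp L] L) : L →+* L) ((gramR L e dV hdV dW hdW).map (algebraMap (Fp L) L)),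
        (S : Matrix (Fin n) (Fin n) L) ≠ 0 → (S : Matrix (Fin n) (Fin n) L).det = 0 →
        ∀ D : ℕ, 1 ≤ D → (∀ i j, IsIntegral ℤ ((D : L) * (S : Matrix (Fin n) (Fin n) L) i j)) →
        ∀ s : ℂ, dist s z < r → ∀ h : HA L e dV hdV dW hdW,
          ‖T S s h‖ ≤ C * adelicHeightGL (n + n) L (h : GL (Fin (n + n)) (AdeleRing (𝓞 L) L)) ^ a * (D : ℝ) ^ a₂ *
            (Real.exp (-(c * adelicHeightGL (n + n) L (h : GL (Fin (n + n)) (AdeleRing (𝓞 L) L)) ^ (-a') *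
                ‖(fun i j => NumberField.mixedEmbedding L ((S : Matrix (Fin n) (Fin n) L) i j))‖)) *
              (1 + ‖(fun i j => NumberField.mixedEmbedding L ((S : Matrix (Fin n) (Fin n) L) i j))‖) ^ Nb)) :
    ∃ (Ebc : skewMatrices ((IsCMField.complexConj L : L ≃ₐ[Fp L] L) : L →+* L) ((gramR L e dV hdV dW hdW).map (algebraMap (Fp L) L)) → ℂ → HA L e dV hdV dW hdW → ℂ),
      (∀ S x, DifferentiableOn ℂ (fun s => Ebc S s x) {s : ℂ | 0 < s.re}) ∧
      (∀ S : skewMatrices ((IsCMField.complexConj L : L ≃ₐ[Fp L] L) : L →+* L) ((gramR L e dV hdV dW hdW).map (algebraMap (Fp L) L)),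
        (S : Matrix (Fin n) (Fin n) L) ≠ 0 → (S : Matrix (Fin n) (Fin n) L).det = 0 → ∀ (s : ℂ) (h : HA L e dV hdV dW hdW), (n : ℝ) / 2 < s.re →
          ((∫⁻ u, β u ∂νN).toReal⁻¹ : ℝ) •
            (∫ u, (β u).toReal • (conj (unipDeltaChar L e dV hdV dW hdW (S : Matrix (Fin n) (Fin n) L) (u : HA L e dV hdV dW hdW) : ℂ) *
              (∑' q : ↥(({Quotient.mk (MulAction.orbitRel (siegelDeltaRat L e dV hdV dW hdW) (ratH L e dV hdV dW hdW)) 1} ∪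
                Set.range (fun ν : unipDeltaRat L e dV hdV dW hdW =>
                  (Quotient.mk (MulAction.orbitRel (siegelDeltaRat L e dV hdV dW hdW) (ratH L e dV hdV dW hdW)) (wq ν) :
                    SiegelDeltaQuot L e dV hdV dW hdW)))ᶜ : Set (SiegelDeltaQuot L e dV hdV dW hdW)),
                f s ((((Quotient.out (q : SiegelDeltaQuot L e dV hdV dW hdW) : ratH L e dV hdV dW hdW) : HA L e dV hdV dW hdW)) *
                  ((u : HA L e dV hdV dW hdW) * h)))) ∂νN) = Ebc S s h) ∧
      ∃ (τb : skewMatrices ((IsCMField.complexConj L : L ≃ₐ[Fp L] L) : L →+* L) ((gramR L e dV hdV dW hdW).map (algebraMap (Fp L) L)) → ℝ),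
        (∀ S : skewMatrices ((IsCMField.complexConj L : L ≃ₐ[Fp L] L) : L →+* L) ((gramR L e dV hdV dW hdW).map (algebraMap (Fp L) L)),
          ‖(fun i j => NumberField.mixedEmbedding L ((S : Matrix (Fin n) (Fin n) L) i j))‖ ≤ τb S) ∧
        ∃ Nb : ℕ,
          (∀ z : ℂ, 0 < z.re → ∃ C a c a' r : ℝ, 0 ≤ C ∧ 0 ≤ a ∧ 0 < c ∧ 0 ≤ a' ∧ 0 < r ∧ ∀ S (s : ℂ), dist s z < r → ∀ h : HA L e dV hdV dW hdW,
            ‖Ebc S s h‖ ≤ C * adelicHeightGL (n + n) L (h : GL (Fin (n + n)) (AdeleRing (𝓞 L) L)) ^ a *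
              (Real.exp (-(c * adelicHeightGL (n + n) L (h : GL (Fin (n + n)) (AdeleRing (𝓞 L) L)) ^ (-a') * τb S)) * (1 + τb S) ^ Nb)) ∧
          ∃ Cb κb : ℝ, 0 < Cb ∧ 0 ≤ κb ∧
            (∀ S (s : ℂ) (h : HA L e dV hdV dW hdW), 0 < s.re → Ebc S s h ≠ 0 →
              ∃ D : ℕ, 1 ≤ D ∧ (D : ℝ) ≤ Cb * adelicHeightGL (n + n) L (h : GL (Fin (n + n)) (AdeleRing (𝓞 L) L)) ^ κb ∧
                ∀ i j, IsIntegral ℤ ((D : L) * (S : Matrix (Fin n) (Fin n) L) i j)) := by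
  -- `n = 2`, so `0 < n`
  have hn : 0 < n := by
    have h2 : Fintype.card (Fin 2 × Fin 1) = Fintype.card (Fin n) := Fintype.card_congr e
    simp only [Fintype.card_prod, Fintype.card_fin] at h2
    omega
  have hn0 : (0 : ℝ) ≤ (n : ℝ) / 2 := by positivity
  have hχ : (toHeckeCharacter L lam⁻¹).IsUnitary := isUnitary_toHeckeCharacter L lam⁻¹
  -- THE SHAPE OF `E`
  set E : skewMatrices ((IsCMField.complexConj L : L ≃ₐ[Fp L] L) : L →+* L) ((gramR L e dV hdV dW hdW).map (algebraMap (Fp L) L)) → ℂ →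
      HA L e dV hdV dW hdW → ℂ := fun S s h => if (S : Matrix (Fin n) (Fin n) L) ≠ 0 ∧ (S : Matrix (Fin n) (Fin n) L).det = 0 then T S s h else 0 with hE
  -- (hol)
  have hEd : ∀ S x, DifferentiableOn ℂ (fun s => E S s x) {s : ℂ | 0 < s.re} := by
    intro S x
    by_cases hS : (S : Matrix (Fin n) (Fin n) L) ≠ 0 ∧ (S : Matrix (Fin n) (Fin n) L).det = 0
    · simp only [hE, if_pos hS]; exact hTd S hS.1 hS.2 x
    · simp only [hE, if_neg hS]; exact differentiableOn_const _
  -- (pin)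
  have hpin : ∀ S : skewMatrices ((IsCMField.complexConj L : L ≃ₐ[Fp L] L) : L →+* L) ((gramR L e dV hdV dW hdW).map (algebraMap (Fp L) L)),
      (S : Matrix (Fin n) (Fin n) L) ≠ 0 → (S : Matrix (Fin n) (Fin n) L).det = 0 → ∀ (s : ℂ) (h : HA L e dV hdV dW hdW), (n : ℝ) / 2 < s.re →
        ((∫⁻ u, β u ∂νN).toReal⁻¹ : ℝ) •
          (∫ u, (β u).toReal • (conj (unipDeltaChar L e dV hdV dW hdW (S : Matrix (Fin n) (Fin n) L) (u : HA L e dV hdV dW hdW) : ℂ) *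
            (∑' q : ↥(({Quotient.mk (MulAction.orbitRel (siegelDeltaRat L e dV hdV dW hdW) (ratH L e dV hdV dW hdW)) 1} ∪
              Set.range (fun ν : unipDeltaRat L e dV hdV dW hdW =>
                (Quotient.mk (MulAction.orbitRel (siegelDeltaRat L e dV hdV dW hdW) (ratH L e dV hdV dW hdW)) (wq ν) :
                  SiegelDeltaQuot L e dV hdV dW hdW)))ᶜ : Set (SiegelDeltaQuot L e dV hdV dW hdW)),
              f s ((((Quotient.out (q : SiegelDeltaQuot L e dV hdV dW hdW) : ratH L e dV hdV dW hdW) : HA L e dV hdV dW hdW)) *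
                ((u : HA L e dV hdV dW hdW) * h)))) ∂νN) = E S s h := by
    intro S hS0 hdet s h hs
    rw [hTpin S hS0 hdet s h hs]
    simp only [hE, if_pos (And.intro hS0 hdet)]
  -- (supp½) INTRINSICALLY (★ (P-supp)), read through the pin
  -- the level of the family (★ (ρ7)) and the lattice letters at that level, read in `Kf`-currency (★ `conj_mem_of_archPart_eq_one`)
  obtain ⟨U, Kf, hUo, hKfiff, -, hKf⟩ := exists_levelSubgroup_of_isStandardSectionFamily h𝒦 hstd hcont
  obtain ⟨Tδ, δ, k, hδ, hlat'⟩ := hlatU U hUo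
  have hlat : ∀ (S : skewMatrices ((IsCMField.complexConj L : L ≃ₐ[Fp L] L) : L →+* L) ((gramR L e dV hdV dW hdW).map (algebraMap (Fp L) L)))
      (h : HA L e dV hdV dW hdW),
      (∀ b : unipDelta L e dV hdV dW hdW, h⁻¹ * (b : HA L e dV hdV dW hdW) * h ∈ Kf →
        unipDeltaChar L e dV hdV dW hdW (S : Matrix (Fin n) (Fin n) L) (b : HA L e dV hdV dW hdW) = 1) →
      ∀ w : HeightOneSpectrum (𝓞 L), ∃ m : ℕ,
        ((Ideal.absNorm w.asIdeal : ℕ) : ℝ) ^ m ≤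
            ((Ideal.absNorm w.asIdeal : ℕ) : ℝ) ^ δ w * (GLn.localHeight (n + n) L w (h : GL (Fin (n + n)) (AdeleRing (𝓞 L) L)) : ℝ) ^ k ∧
          ∀ a b, Valued.v ((((S : Matrix (Fin n) (Fin n) L) a b : L)) : w.adicCompletion L) ≤ WithZero.exp (m : ℤ) :=
    fun S h hKfS => hlat' S h (fun b hb hfin => hKfS b (conj_mem_of_archPart_eq_one hKfiff hb h hfin))
  obtain ⟨Cb, κb, hCb, hκb, hsuppM⟩ := hsupp_middle_of_letters L e dV hdV dW hdW hn hdV0 hdW0 hχ (fun s => hstd.1.1 s) hcont νN hβ hβtop hK hβK wq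
    Kf hKf hrestL Tδ δ hδ k hlat
  have hsupp : ∀ S (s : ℂ) (h : HA L e dV hdV dW hdW), (n : ℝ) / 2 < s.re → E S s h ≠ 0 →
      ∃ D : ℕ, 1 ≤ D ∧ (D : ℝ) ≤ Cb * adelicHeightGL (n + n) L (h : GL (Fin (n + n)) (AdeleRing (𝓞 L) L)) ^ κb ∧
        ∀ i j, IsIntegral ℤ ((D : L) * (S : Matrix (Fin n) (Fin n) L) i j) := by
    intro S s h hs hne
    have hS : (S : Matrix (Fin n) (Fin n) L) ≠ 0 ∧ (S : Matrix (Fin n) (Fin n) L).det = 0 := by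
      by_contra hS
      exact hne (by simp only [hE, if_neg hS])
    have hT : T S s h ≠ 0 := by simpa only [hE, if_pos hS] using hne
    exact hsuppM S s h hs (by rw [hTpin S hS.1 hS.2 s h hs]; exact hT)
  -- … and on the whole window (★ p863141 §1, identity theorem)
  have hsupp0 : ∀ S (s : ℂ) (h : HA L e dV hdV dW hdW), 0 < s.re → E S s h ≠ 0 →
      ∃ D : ℕ, 1 ≤ D ∧ (D : ℝ) ≤ Cb * adelicHeightGL (n + n) L (h : GL (Fin (n + n)) (AdeleRing (𝓞 L) L)) ^ κb ∧
        ∀ i j, IsIntegral ℤ ((D : L) * (S : Matrix (Fin n) (Fin n) L) i j) :=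
    support_of_support_on_halfPlane hEd hn0
      (P := fun S (h : HA L e dV hdV dW hdW) => ∃ D : ℕ, 1 ≤ D ∧ (D : ℝ) ≤ Cb * adelicHeightGL (n + n) L (h : GL (Fin (n + n)) (AdeleRing (𝓞 L) L)) ^ κb ∧
        ∀ i j, IsIntegral ℤ ((D : L) * (S : Matrix (Fin n) (Fin n) L) i j)) hsupp
  -- (dec): the support denominator fed into the `D`-polynomial decay letter
  have hdec : ∀ z : ℂ, 0 < z.re → ∃ C a c a' r : ℝ, 0 ≤ C ∧ 0 ≤ a ∧ 0 < c ∧ 0 ≤ a' ∧ 0 < r ∧ ∀ S (s : ℂ), dist s z < r → ∀ h : HA L e dV hdV dW hdW,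
      ‖E S s h‖ ≤ C * adelicHeightGL (n + n) L (h : GL (Fin (n + n)) (AdeleRing (𝓞 L) L)) ^ a *
        (Real.exp (-(c * adelicHeightGL (n + n) L (h : GL (Fin (n + n)) (AdeleRing (𝓞 L) L)) ^ (-a') *
            ‖(fun i j => NumberField.mixedEmbedding L ((S : Matrix (Fin n) (Fin n) L) i j))‖)) *
          (1 + ‖(fun i j => NumberField.mixedEmbedding L ((S : Matrix (Fin n) (Fin n) L) i j))‖) ^ Nb) := by
    intro z hz
    obtain ⟨C, a, a₂, c, a', r, hC, ha, ha₂, hc, ha', hr, hT⟩ := hTdec z hz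
    refine ⟨C * Cb ^ a₂, a + κb * a₂, c, a', min r z.re, mul_nonneg hC (Real.rpow_nonneg hCb.le _), add_nonneg ha (mul_nonneg hκb ha₂), hc, ha',
      lt_min hr hz, fun S s hs h => ?_⟩
    have hH : 0 ≤ adelicHeightGL (n + n) L (h : GL (Fin (n + n)) (AdeleRing (𝓞 L) L)) := adelicHeightGL_nonneg _
    have hτ : 0 ≤ ‖(fun i j => NumberField.mixedEmbedding L ((S : Matrix (Fin n) (Fin n) L) i j))‖ := norm_nonneg _
    by_cases hne : E S s h = 0
    · rw [hne, norm_zero]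
      exact mul_nonneg (mul_nonneg (mul_nonneg hC (Real.rpow_nonneg hCb.le _)) (Real.rpow_nonneg hH _))
        (mul_nonneg (Real.exp_pos _).le (pow_nonneg (by linarith) _))
    · -- rank-one, `0 < re s`, a support denominator `D ≤ Cb · H^κb`
      have hS : (S : Matrix (Fin n) (Fin n) L) ≠ 0 ∧ (S : Matrix (Fin n) (Fin n) L).det = 0 := by
        by_contra hS
        exact hne (by simp only [hE, if_neg hS])
      have hs0 : 0 < s.re := by
        have h1 : dist s z < z.re := lt_of_lt_of_le hs (min_le_right _ _)
        have h2 : |s.re - z.re| ≤ dist s z := by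
          rw [Complex.dist_eq]
          simpa only [Complex.sub_re] using Complex.abs_re_le_norm (s - z)
        have h3 := (abs_lt.1 (lt_of_le_of_lt h2 h1)).1
        linarith
      obtain ⟨D, hD1, hDle, hDint⟩ := hsupp0 S s h hs0 hne
      have hmain := hT S hS.1 hS.2 D hD1 hDint s (lt_of_lt_of_le hs (min_le_left _ _)) h
      have hEeq : E S s h = T S s h := by simp only [hE, if_pos hS]
      rw [hEeq]
      refine hmain.trans ?_
      -- the pure real algebra: `D^{a₂} ≤ Cb^{a₂} · H^{κb a₂}`, `H^a · H^{κb a₂} = H^{a + κb a₂}`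
      generalize adelicHeightGL (n + n) L (h : GL (Fin (n + n)) (AdeleRing (𝓞 L) L)) = H at hH hDle ⊢
      generalize ‖(fun i j => NumberField.mixedEmbedding L ((S : Matrix (Fin n) (Fin n) L) i j))‖ = τ at hτ ⊢
      have hX : 0 ≤ Real.exp (-(c * H ^ (-a') * τ)) * (1 + τ) ^ Nb := mul_nonneg (Real.exp_pos _).le (pow_nonneg (by linarith) _)
      have hD : (D : ℝ) ^ a₂ ≤ Cb ^ a₂ * H ^ (κb * a₂) := by
        calc (D : ℝ) ^ a₂ ≤ (Cb * H ^ κb) ^ a₂ := Real.rpow_le_rpow (Nat.cast_nonneg D) hDle ha₂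
          _ = Cb ^ a₂ * H ^ (κb * a₂) := by rw [Real.mul_rpow hCb.le (Real.rpow_nonneg hH κb), Real.rpow_mul hH]
      have hsplit : H ^ (a + κb * a₂) = H ^ a * H ^ (κb * a₂) := Real.rpow_add_of_nonneg hH ha (mul_nonneg hκb ha₂)
      calc C * H ^ a * (D : ℝ) ^ a₂ * (Real.exp (-(c * H ^ (-a') * τ)) * (1 + τ) ^ Nb)
          ≤ C * H ^ a * (Cb ^ a₂ * H ^ (κb * a₂)) * (Real.exp (-(c * H ^ (-a') * τ)) * (1 + τ) ^ Nb) :=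
            mul_le_mul_of_nonneg_right (mul_le_mul_of_nonneg_left hD (mul_nonneg hC (Real.rpow_nonneg hH a))) hX
        _ = C * Cb ^ a₂ * H ^ (a + κb * a₂) * (Real.exp (-(c * H ^ (-a') * τ)) * (1 + τ) ^ Nb) := by rw [hsplit]; ring
  -- ★ p863141: the twelve letters
  exact exists_kindOne_lineTermPackage_of_letters L e dV hdV hdV0 dW hdW hdW0 lam hlam hw 𝒦 h𝒦 f hstd hcont νN β hβ hβ0 hβtop hK hβK wq hwq E hEd hpin
    (fun S => ‖(fun i j => NumberField.mixedEmbedding L ((S : Matrix (Fin n) (Fin n) L) i j))‖) (fun S => le_rfl) Nb hdec hCb hκb hsupp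

end Summit.HodgeConjecture.HodgeConjecture.Cruxes.HLiu418.K2LiuKindOneLineTermEngine

end
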